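import Literature.AlgebraicGeometry.Resolution.AlterationsNodalMonomialization
import Literature.AlgebraicGeometry.Resolution.AlterationsFormalNodesSingProofs
import Literature.AlgebraicGeometry.Resolution.AlterationsNodalStructure
import Literature.AlgebraicGeometry.Resolution.AlterationsSingGenerization
import Literature.AlgebraicGeometry.Resolution.AlterationsSingFittingProofs
import Literature.AlgebraicGeometry.Resolution.SmoothOfRegularFibre
import Literature.AlgebraicGeometry.Resolution.NodalFamilyRingDomain
import HarnessLib

/-!
# De Jong 1996, 2.23 + 3.3 (split case) — the discharge `DeJong1996SplitNodalStructure_holds`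

Topic: `Literature/AlgebraicGeometry/Resolution`. Discharge of the named fact
`DeJong1996SplitNodalStructure` of `AlterationsFormalNodes.lean` (de Jong 1996, 2.23 with 3.3 in
the split case, at a closed point of `Sing(f)` of the curve of a pair in Situation 4.23 over an
algebraically closed field), kept out of that file only because its ingredients import it.
Everything is PROVED; no definition, no named fact. The printed argument and its rendering:

1. **2.23 (split case)**, "The complete local ring of `X` at `x` is `B ≅ A⟦u, v⟧/(uv - h)` for
   some `h ∈ A`" (p. 62): PROVED in the tree as
   `DeJong1996.SemiStablePair.exists_ringEquiv_nodeDeformationRing`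
   (`AlterationsNodalStructure.lean`, via Liu 2002, Lemma 10.3.20), at a closed point whose fibre
   is singular, which a closed point of `Sing(f)` is
   (`not_isRegularLocalRing_stalk_fiber_of_not_smooth`, `SmoothOfRegularFibre.lean`);
   written on Cohen coordinates `𝒪̂_{Y,f x} ≅ Λ = k⟦T₁, …, T_m⟧`, `tᵢ ↦ Tᵢ`
   (`exists_ringEquiv_adicCompletion_stalk_mvPowerSeries`) it reads
   `e : 𝒪̂_{X,x} ≅ Λ⟦u, v⟧/(uv - h)` with `e(f^# a) = C(â)` for all `a ∈ 𝒪_{Y,f x}`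
   (`exists_ringEquiv_nodeDeformationRing_cohen`).
2. **3.3**, "The singular locus of `f` traced on `Spec B` maps isomorphically to the closed
   subscheme `V(h) ⊂ Spec A'`. By assumption we have `V(h) ⊂ V(t₁ ⋯ t_r)`. Therefore we see that
   `h = ε t₁^{n₁} ⋯ t_r^{n_r}`" (p. 63): `dvd_pow_of_not_smooth` — the residues `∂/∂u`, `∂/∂v` at
   `u = v = 0` (`DeJong1996.NodeDeformationRing.coeffDerivation`,
   `AlterationsNodalMonomialization.lean`) pulled back to `𝒪_{X,x}` are two derivations over
   `𝒪_{Y,f x}` independent at lifts of `u`, `v`, so `Fitt₁(Ω_{X/Y})_x` dies in `Λ/(h)`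
   (`Module.map_fittingIdeal_kaehlerDifferential_one_eq_bot_of_derivation`; this is the needed
   half of the Remark of 2.23, "the trace of `Sing(f)` on `Spec B` is given by the ideal
   `(u, v)`"); on the other hand `I(D)_{f x} 𝒪_{X,x} ⊆ √Fitt₁(Ω_{X/Y})_x` by smoothness over
   `Y ∖ D` (`map_stalkIdeal_le_of_singFittingIdeal_le`, `AlterationsSingGenerization.lean`;
   `𝒪_{X,x}` is a domain and `Fitt₁ ≠ 0`, else `𝔪_x = 𝔪_{f x}𝒪_{X,x}` by 2.21,
   `DeJong1996SingUnramified_holds`, and the fibre would be regular at `x`); hence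
   `h ∣ (∏_{i<r} Tᵢ)^N` in `Λ`, and a divisor of a product of the prime elements `Tᵢ` is
   `ε ∏ Tᵢ^{nᵢ}` (`exists_eq_units_mul_prod_pow_of_dvd_prod_pow`).
3. "We change `Q` into `ε⁻¹ Q`" (`DeJong1996.NodeDeformationRing.absorbUnit`) and rebracket
   `Λ⟦u, v⟧/(uv - ∏ Tᵢ^{νᵢ}) ≅ k⟦u, v, T⟧/(uv - ∏ Tᵢ^{νᵢ})`
   (`DeJong1996.NodeDeformationRing.toFormalNodeRing`, `AlterationsFormalNodesSingProofs.lean`).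

Consequence for the cone: `DeJong1996NodeLocalStructure` (`AlterationsNodeLocalStructure.lean`)
differs from the fact discharged here by the clause "`x` regular iff `Σ nᵢ = 1`", which
`AlterationsFormalNodesRegular.lean` derives from the split nodal structure.

## Sources

* A. J. de Jong, *Smoothness, semi-stability and alterations*, Publ. Math. IHÉS 83 (1996) 51–93:
  2.21, 2.23 with its Remark (pp. 61–62), 3.3 (p. 63), 4.24 (p. 75). [DeJong1996]
* Q. Liu, *Algebraic Geometry and Arithmetic Curves* (2002), Lemma 10.3.20 (via
  `NodalDeformation.lean`).
* H. Matsumura, *Commutative Ring Theory* (1986), Thm. 29.7 (Cohen), via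
  `AlterationsFormalCoordinates.lean`.
-/

noncomputable section

open CategoryTheory CategoryTheory.Limits AlgebraicGeometry TopologicalSpace IsLocalRing

namespace Literature.AlgebraicGeometry.Resolution

universe u

open Scheme.IdealSheafData

namespace DeJong1996.SemiStablePair

variable {k : Type u} [Field k] {X Y : Scheme.{u}} {f : X ⟶ Y} {g : Y ⟶ Spec (.of k)}
  {D : Set Y} {n : ℕ} {τ : Fin n → (Y ⟶ X)}

/-- **2.23 (split case) in Cohen coordinates, with its compatibility on the whole base.** At a
closed point `x` at which the fibre is singular, for generators `z₁, …, z_m` of `𝔪_{Y,f x}`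
(`m = dim 𝒪_{Y,f x}`): Cohen coordinates `eA : 𝒪̂_{Y,f x} ≅ Λ = k⟦T₁, …, T_m⟧`, `zᵢ ↦ Tᵢ`, a
non-unit `h ∈ Λ` and `e : 𝒪̂_{X,x} ≅ Λ⟦u, v⟧/(uv - h)` with `e(f^# a) = C (eA â)` for every
`a ∈ 𝒪_{Y,f x}` ("`B ≅ A⟦u, v⟧/(uv - h)` for some `h ∈ A`", as `A`-algebras).
[cite: DeJong1996, 2.23, pp. 61–62] -/
theorem exists_ringEquiv_nodeDeformationRing_cohen [IsAlgClosed k] (hS : SemiStablePair f g D τ)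
    {x : X} (hx : IsClosed ({x} : Set X))
    (hsing : ¬ IsRegularLocalRing ((f.fiber (f x)).presheaf.stalk (f.asFiber x))) {m : ℕ}
    (z : Fin m → Y.presheaf.stalk (f x))
    (hz : Ideal.span (Set.range z) = maximalIdeal (Y.presheaf.stalk (f x)))
    (hm : ringKrullDim (Y.presheaf.stalk (f x)) = m) :
    ∃ (h : MvPowerSeries (Fin m) k)
      (eA : AdicCompletion (maximalIdeal (Y.presheaf.stalk (f x))) (Y.presheaf.stalk (f x)) ≃+*
        MvPowerSeries (Fin m) k)
      (e : AdicCompletion (maximalIdeal (X.presheaf.stalk x)) (X.presheaf.stalk x) ≃+*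
        DeJong1996.NodeDeformationRing (MvPowerSeries (Fin m) k) h),
      ¬ IsUnit h ∧ (∀ i, eA (algebraMap _ _ (z i)) = MvPowerSeries.X i) ∧
        ∀ a, e (algebraMap _ _ ((f.stalkMap x).hom a)) =
          Ideal.Quotient.mk _ (MvPowerSeries.C (eA (algebraMap _ _ a))) := by
  have hy := hS.isClosed_image hx
  haveI : IsProper g :=
    Literature.AlgebraicGeometry.Motives.IsProjectiveOver.isProper (X := Over.mk g)
      hS.isProjectiveOver_base
  haveI : IsRegularLocalRing (Y.presheaf.stalk (f x)) := hS.isRegular_base (f x)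
  -- 2.23
  obtain ⟨h₀, e₀, hh₀, hC⟩ := hS.exists_ringEquiv_nodeDeformationRing hx hsing
  -- Cohen coordinates on the base
  obtain ⟨eA, heA⟩ := exists_ringEquiv_adicCompletion_stalk_mvPowerSeries g hy z hz hm
  refine ⟨eA h₀, eA, e₀.symm.trans (DeJong1996.NodeDeformationRing.congr eA h₀ (eA h₀) rfl),
    fun hu => hh₀ (by simpa using hu.map eA.symm), heA, fun a => ?_⟩
  have h1 : algebraMap _ (AdicCompletion (maximalIdeal (X.presheaf.stalk x)) (X.presheaf.stalk x))
      ((f.stalkMap x).hom a) =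
        e₀ (Ideal.Quotient.mk _ (MvPowerSeries.C (algebraMap _
          (AdicCompletion (maximalIdeal (Y.presheaf.stalk (f x))) (Y.presheaf.stalk (f x)))
            a))) := by
    rw [hC, AdicCompletion.algebraMap_apply, Algebra.algebraMap_self_apply,
      AdicCompletion.algebraMap_apply, Algebra.algebraMap_self_apply,
      DeJong1996.completedStalkMap_of]
  rw [RingEquiv.trans_apply, h1, RingEquiv.symm_apply_apply,
    DeJong1996.NodeDeformationRing.congr_mk_C]

/-- **de Jong 1996, 3.3: "By assumption we have `V(h) ⊂ V(t₁ ⋯ t_r)`" — `h` divides a power of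
the image of the local equation of `D`.** In the situation of
`exists_ringEquiv_nodeDeformationRing_cohen` at a closed point `x` of `Sing(f)`
(`e : 𝒪̂_{X,x} ≅ Λ⟦u, v⟧/(uv - h)` over Cohen coordinates `eA : 𝒪̂_{Y,f x} ≅ Λ`), if
`I(D)_{f x} = (a₀)`
then `h ∣ (eA â₀)^N` for some `N`. Proof: the residues `∂/∂u |_{u=v=0}`, `∂/∂v |_{u=v=0}`
(`coeffDerivation`) pulled back along `𝒪_{X,x} → Λ⟦u, v⟧/(uv - h)` are `𝒪_{Y,f x}`-derivations
with values in `Λ/(h)`, independent at lifts of `u`, `v` modulo `𝔪̂²`; so `Fitt₁(Ω_{X/Y})_x` dies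
in `Λ/(h)` (the Remark of 2.23: "the trace of `Sing(f)` on the scheme `Spec B` is given by the
ideal `(u, v) ⊂ B`"), whereas `a₀ ∈ √Fitt₁(Ω_{X/Y})_x` because `f` is smooth over `Y ∖ D`
(`map_stalkIdeal_le_of_singFittingIdeal_le`; `𝒪_{X,x}` is a domain and `Fitt₁ ≠ 0`, else
`𝔪_x = 𝔪_{f x}𝒪_{X,x}` by 2.21 and the fibre would be regular at `x`).
[cite: DeJong1996, 3.3, p. 63] -/
theorem dvd_pow_of_not_smooth [IsAlgClosed k] (hS : SemiStablePair f g D τ)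
    {x : X} (hx : IsClosed ({x} : Set X)) (hns : ∀ U : X.Opens, x ∈ U → ¬ Smooth (U.ι ≫ f))
    {m : ℕ} {h : MvPowerSeries (Fin m) k}
    (eA : AdicCompletion (maximalIdeal (Y.presheaf.stalk (f x))) (Y.presheaf.stalk (f x)) ≃+*
        MvPowerSeries (Fin m) k)
    (e : AdicCompletion (maximalIdeal (X.presheaf.stalk x)) (X.presheaf.stalk x) ≃+*
        DeJong1996.NodeDeformationRing (MvPowerSeries (Fin m) k) h)
    (hh : ¬ IsUnit h)
    (he : ∀ a, e (algebraMap _ _ ((f.stalkMap x).hom a)) =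
      Ideal.Quotient.mk _ (MvPowerSeries.C (eA (algebraMap _ _ a))))
    (a₀ : Y.presheaf.stalk (f x))
    (hI : stalkIdeal (vanishingIdeal ⟨D, hS.isStrictNormalCrossingsDivisor.isClosed⟩) (f x) =
      Ideal.span {a₀}) :
    ∃ N : ℕ, h ∣ (eA (algebraMap _ _ a₀)) ^ N := by
  classical
  haveI := hS.isIntegral
  haveI : IsNoetherian X := isNoetherian_of_isProjectiveOver _ hS.isProjectiveOver
  letI algAB : Algebra (Y.presheaf.stalk (f x)) (X.presheaf.stalk x) := (f.stalkMap x).hom.toAlgebra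
  -- the local rings `M = Λ⟦u, v⟧/(uv - h)` and `C = Λ/(h)`
  have hhmax : h ∈ maximalIdeal (MvPowerSeries (Fin m) k) := hh
  haveI hMloc : IsLocalRing (DeJong1996.NodeDeformationRing (MvPowerSeries (Fin m) k) h) :=
    DeJong1996.NodeDeformationRing.isLocalRing hhmax
  have hspan : Ideal.span {h} ≠ ⊤ := by rwa [Ne, Ideal.span_singleton_eq_top]
  haveI hCnt : Nontrivial (MvPowerSeries (Fin m) k ⧸ Ideal.span {h}) :=
    Ideal.Quotient.nontrivial_iff.mpr hspan
  haveI hCloc : IsLocalRing (MvPowerSeries (Fin m) k ⧸ Ideal.span {h}) :=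
    IsLocalRing.of_surjective' (Ideal.Quotient.mk _) Ideal.Quotient.mk_surjective
  haveI : IsLocalHom e.toRingHom := IsLocalHom.of_surjective _ e.surjective
  haveI : IsLocalHom (DeJong1996.NodeDeformationRing.toBaseQuotient (MvPowerSeries (Fin m) k) h) :=
    IsLocalHom.of_surjective _ (DeJong1996.NodeDeformationRing.toBaseQuotient_surjective h)
  -- the ring maps `φ : 𝒪_{X,x} → M`, `φ' : 𝒪_{X,x} → C`
  let φ : X.presheaf.stalk x →+* DeJong1996.NodeDeformationRing (MvPowerSeries (Fin m) k) h :=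
    e.toRingHom.comp (algebraMap (X.presheaf.stalk x)
      (AdicCompletion (maximalIdeal (X.presheaf.stalk x)) (X.presheaf.stalk x)))
  let φ' : X.presheaf.stalk x →+* MvPowerSeries (Fin m) k ⧸ Ideal.span {h} :=
    (DeJong1996.NodeDeformationRing.toBaseQuotient _ h).comp φ
  letI algBC : Algebra (X.presheaf.stalk x) (MvPowerSeries (Fin m) k ⧸ Ideal.span {h}) :=
    φ'.toAlgebra
  letI algAC : Algebra (Y.presheaf.stalk (f x)) (MvPowerSeries (Fin m) k ⧸ Ideal.span {h}) :=
    (φ'.comp (f.stalkMap x).hom).toAlgebra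
  haveI : IsScalarTower (Y.presheaf.stalk (f x)) (X.presheaf.stalk x)
      (MvPowerSeries (Fin m) k ⧸ Ideal.span {h}) :=
    IsScalarTower.of_algebraMap_eq (fun _ => rfl)
  have heφ : ∀ a, φ ((f.stalkMap x).hom a) =
      Ideal.Quotient.mk _ (MvPowerSeries.C (eA (algebraMap _ _ a))) := he
  -- the residues pulled back to `𝒪_{X,x}`: two `𝒪_{Y,f x}`-derivations
  let δ : Fin 2 → Derivation (Y.presheaf.stalk (f x)) (X.presheaf.stalk x)
      (MvPowerSeries (Fin m) k ⧸ Ideal.span {h}) := fun i =>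
    Derivation.ofRingHomOfMapAlgebraMap φ (fun _ _ => rfl)
      (DeJong1996.NodeDeformationRing.coeffDerivation h i)
      (fun a => by
        change DeJong1996.NodeDeformationRing.coeffDerivation h i (φ ((f.stalkMap x).hom a)) = 0
        rw [heφ, DeJong1996.NodeDeformationRing.coeffDerivation_mk_C])
  have hδ : ∀ i b, δ i b = DeJong1996.NodeDeformationRing.coeffDerivation h i (φ b) :=
    fun _ _ => rfl
  -- on `e(𝔪̂²) ⊆ 𝔪_M²` the residues take values in `𝔪_C`
  have hsq : ∀ (i : Fin 2)
      (w : AdicCompletion (maximalIdeal (X.presheaf.stalk x)) (X.presheaf.stalk x)),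
      w ∈ (maximalIdeal _) ^ 2 →
        DeJong1996.NodeDeformationRing.coeffDerivation h i (e w) ∈
          maximalIdeal (MvPowerSeries (Fin m) k ⧸ Ideal.span {h}) := by
    intro i w hw
    have hew : e w ∈
        (maximalIdeal (DeJong1996.NodeDeformationRing (MvPowerSeries (Fin m) k) h)) ^ 2 := by
      have h1 : e.toRingHom w ∈ ((maximalIdeal _) ^ 2).map e.toRingHom := Ideal.mem_map_of_mem _ hw
      rw [Ideal.map_pow] at h1
      refine Ideal.pow_right_mono ?_ 2 h1
      exact Ideal.map_le_iff_le_comap.mpr fun a ha => map_nonunit e.toRingHom a ha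
    rw [sq] at hew
    refine Submodule.mul_induction_on hew (fun p hp q hq => ?_) (fun p q hp hq => ?_)
    · rw [Derivation.leibniz, Algebra.smul_def, Algebra.smul_def,
        DeJong1996.NodeDeformationRing.algebraMap_baseQuotient]
      exact Ideal.add_mem _ (Ideal.mul_mem_right _ _ (map_nonunit _ p hp))
        (Ideal.mul_mem_right _ _ (map_nonunit _ q hq))
    · rw [map_add]
      exact Ideal.add_mem _ hp hq
  -- lifts `b_u`, `b_v ∈ 𝒪_{X,x}` of `u`, `v` modulo `𝔪̂²`
  obtain ⟨bu, hbu⟩ := AdicCompletion.exists_sub_algebraMap_mem_maximalIdeal_sq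
    (e.symm (Ideal.Quotient.mk _ (MvPowerSeries.X 0)))
  obtain ⟨bv, hbv⟩ := AdicCompletion.exists_sub_algebraMap_mem_maximalIdeal_sq
    (e.symm (Ideal.Quotient.mk _ (MvPowerSeries.X 1)))
  set zu := e.symm (Ideal.Quotient.mk _ (MvPowerSeries.X 0)) - algebraMap _ _ bu with hzu
  set zv := e.symm (Ideal.Quotient.mk _ (MvPowerSeries.X 1)) - algebraMap _ _ bv with hzv
  have hφbu : φ bu = Ideal.Quotient.mk _ (MvPowerSeries.X 0) - e zu := by
    change e (algebraMap _ _ bu) = _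
    rw [hzu, map_sub, RingEquiv.apply_symm_apply, sub_sub_cancel]
  have hφbv : φ bv = Ideal.Quotient.mk _ (MvPowerSeries.X 1) - e zv := by
    change e (algebraMap _ _ bv) = _
    rw [hzv, map_sub, RingEquiv.apply_symm_apply, sub_sub_cancel]
  -- the values of the residues at the lifts: the identity matrix modulo `𝔪_C`
  set a := DeJong1996.NodeDeformationRing.coeffDerivation h 0 (e zu) with ha
  set b := DeJong1996.NodeDeformationRing.coeffDerivation h 1 (e zu) with hb
  set c := DeJong1996.NodeDeformationRing.coeffDerivation h 0 (e zv) with hc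
  set d := DeJong1996.NodeDeformationRing.coeffDerivation h 1 (e zv) with hd
  have hv00 : δ 0 bu = 1 - a := by
    rw [hδ, hφbu, map_sub, DeJong1996.NodeDeformationRing.coeffDerivation_mk_X, if_pos rfl]
  have hv10 : δ 1 bu = 0 - b := by
    rw [hδ, hφbu, map_sub, DeJong1996.NodeDeformationRing.coeffDerivation_mk_X, if_neg (by decide)]
  have hv01 : δ 0 bv = 0 - c := by
    rw [hδ, hφbv, map_sub, DeJong1996.NodeDeformationRing.coeffDerivation_mk_X, if_neg (by decide)]
  have hv11 : δ 1 bv = 1 - d := by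
    rw [hδ, hφbv, map_sub, DeJong1996.NodeDeformationRing.coeffDerivation_mk_X, if_pos rfl]
  -- hence a unit determinant
  have hdet : IsUnit (δ 0 bu * δ 1 bv - δ 1 bu * δ 0 bv) := by
    have hw : a + d - a * d + b * c ∈ maximalIdeal (MvPowerSeries (Fin m) k ⧸ Ideal.span {h}) :=
      Ideal.add_mem _ (Ideal.sub_mem _ (Ideal.add_mem _ (hsq 0 zu hbu) (hsq 1 zv hbv))
        (Ideal.mul_mem_left _ _ (hsq 1 zv hbv))) (Ideal.mul_mem_left _ _ (hsq 0 zv hbv))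
    have hexp : δ 0 bu * δ 1 bv - δ 1 bu * δ 0 bv = 1 - (a + d - a * d + b * c) := by
      rw [hv00, hv10, hv01, hv11]
      ring
    rw [hexp]
    by_contra hnu
    have h1 : (1 : MvPowerSeries (Fin m) k ⧸ Ideal.span {h}) ∈ maximalIdeal _ := by
      have := Ideal.add_mem _ ((mem_maximalIdeal _).mpr hnu) hw
      rwa [sub_add_cancel] at this
    exact (maximalIdeal.isMaximal _).ne_top (Ideal.eq_top_of_isUnit_mem _ h1 isUnit_one)
  -- so `Fitt₁(Ω_{X/Y})_x` dies in `C = Λ/(h)`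
  have hF : (Scheme.Hom.singFittingIdeal f x).map φ' = ⊥ :=
    Module.map_fittingIdeal_kaehlerDifferential_one_eq_bot_of_derivation (δ 0) (δ 1) bu bv hdet
  -- `Fitt₁(Ω_{X/Y})_x ≠ 0`: else `𝔪_x = 𝔪_{f x} 𝒪_{X,x}` (2.21) and the fibre is regular at `x`
  have hFne : Scheme.Hom.singFittingIdeal f x ≠ ⊥ := by
    intro hF0
    have hun := (DeJong1996SingUnramified_holds X Y f hS.isSemiStableCurve x
      (by rw [hF0]; exact bot_ne_top)).1
    rw [hF0, bot_sup_eq] at hun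
    have heq : (maximalIdeal (Y.presheaf.stalk (f x))).map (f.stalkMap x).hom =
        maximalIdeal (X.presheaf.stalk x) :=
      le_antisymm (DeJong1996.map_maximalIdeal_stalkMap_le f x) hun
    obtain ⟨e₀⟩ := Literature.AlgebraicGeometry.Motives.nonempty_stalkFiber_ringEquiv_asFiber f x
    apply hS.not_isRegularLocalRing_stalk_fiber_of_not_smooth hx hns
    have hfield : IsField (X.presheaf.stalk x ⧸
        (maximalIdeal (Y.presheaf.stalk (f x))).map (f.stalkMap x).hom) := by
      rw [heq]
      exact (Ideal.Quotient.maximal_ideal_iff_isField_quotient _).mp (maximalIdeal.isMaximal _)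
    haveI : IsRegularLocalRing (X.presheaf.stalk x ⧸
        (maximalIdeal (Y.presheaf.stalk (f x))).map (f.stalkMap x).hom) := by
      letI := hfield.toField
      infer_instance
    exact IsRegularLocalRing.of_ringEquiv e₀.symm
  -- `I(D)_{f x} 𝒪_{X,x} ⊆ √Fitt₁(Ω_{X/Y})_x` (smoothness over `Y ∖ D`)
  have hrad : (stalkIdeal (vanishingIdeal ⟨D, hS.isStrictNormalCrossingsDivisor.isClosed⟩)
      (f x)).map (f.stalkMap x).hom ≤ (Scheme.Hom.singFittingIdeal f x).radical := by
    rw [Ideal.radical_eq_sInf]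
    refine le_sInf ?_
    rintro P ⟨hFP, hP⟩
    haveI := hP
    refine hS.map_stalkIdeal_le_of_singFittingIdeal_le P hFP (fun s hs => ?_)
    obtain ⟨q, hqF, hq0⟩ := Submodule.exists_mem_ne_zero_of_ne_bot hFne
    rcases mul_eq_zero.mp (hs q hqF) with h0 | h0
    · rw [h0]
      exact P.zero_mem
    · exact (hq0 h0).elim
  have ha₀ : (f.stalkMap x).hom a₀ ∈ (Scheme.Hom.singFittingIdeal f x).radical := by
    refine hrad (Ideal.mem_map_of_mem _ ?_)
    rw [hI]
    exact Ideal.mem_span_singleton_self a₀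
  obtain ⟨N, hN⟩ := Ideal.mem_radical_iff.mp ha₀
  refine ⟨N, ?_⟩
  have h0 : φ' (((f.stalkMap x).hom a₀) ^ N) = 0 := by
    have h1 : φ' (((f.stalkMap x).hom a₀) ^ N) ∈ (Scheme.Hom.singFittingIdeal f x).map φ' :=
      Ideal.mem_map_of_mem _ hN
    rwa [hF, Ideal.mem_bot] at h1
  have hφ'a : φ' ((f.stalkMap x).hom a₀) =
      Ideal.Quotient.mk (Ideal.span {h}) (eA (algebraMap _ _ a₀)) := by
    change DeJong1996.NodeDeformationRing.toBaseQuotient _ h (φ ((f.stalkMap x).hom a₀)) = _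
    rw [heφ, DeJong1996.NodeDeformationRing.toBaseQuotient_mk_C]
  rw [map_pow, hφ'a, ← map_pow, Ideal.Quotient.eq_zero_iff_mem, Ideal.mem_span_singleton] at h0
  exact h0

end DeJong1996.SemiStablePair

/-! ## The discharge -/

/-- **de Jong 1996, 2.23 with 3.3 (split case) at a closed point of `Sing(f)` — THE DISCHARGE of
`DeJong1996SplitNodalStructure`.** For the curve `f : X → Y` of a pair in Situation 4.23 over an
algebraically closed field, a closed point `x` lying in no open on which `f` is smooth, and a
regular system of parameters `t₁, …, t_m` of `𝒪_{Y,f x}` with `I(D)_{f x} = (∏_{i<r} tᵢ)`: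
`𝒪̂_{X,x} ≅ k⟦u, v, T₁, …, T_m⟧/(uv - ∏ Tᵢ^{νᵢ})` with `νᵢ = 0` for `i ≥ r` and `f^#(tᵢ) ↦ Tᵢ`.
Assembly: 2.23 on Cohen coordinates (`exists_ringEquiv_nodeDeformationRing_cohen`); 3.3
(`dvd_pow_of_not_smooth`: `h ∣ (∏_{i<r} Tᵢ)^N`, so `h = ε ∏_{i<r} Tᵢ^{nᵢ}` by
`exists_eq_units_mul_prod_pow_of_dvd_prod_pow`, the `Tᵢ` being prime); "we change `Q` into
`ε⁻¹ Q`" (`absorbUnit`); rebracketing (`toFormalNodeRing`).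
[cite: DeJong1996, 2.23 and 3.3, pp. 61–63] -/
theorem DeJong1996SplitNodalStructure_holds : DeJong1996SplitNodalStructure.{u} := by
  intro k _ _ X Y f g D n τ hS x hx hns m r t ht hm _ hI
  classical
  -- 2.23 on Cohen coordinates
  have hsing := hS.not_isRegularLocalRing_stalk_fiber_of_not_smooth hx hns
  obtain ⟨h, eA, e, hh, heA, he⟩ := hS.exists_ringEquiv_nodeDeformationRing_cohen hx hsing t ht hm
  -- 3.3: `h ∣ (∏_{i<r} Tᵢ)^N`
  set s : Finset (Fin m) := Finset.univ.filter (fun i : Fin m => i.val < r) with hs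
  obtain ⟨N, hN⟩ := hS.dvd_pow_of_not_smooth hx hns eA e hh he (∏ i ∈ s, t i) hI
  have hprod : eA (algebraMap _ _ (∏ i ∈ s, t i)) =
      ∏ i ∈ s, (MvPowerSeries.X i : MvPowerSeries (Fin m) k) := by
    rw [map_prod, map_prod]
    exact Finset.prod_congr rfl fun i _ => heA i
  rw [hprod, ← Finset.prod_pow] at hN
  -- `h = ε ∏_{i<r} Tᵢ^{nᵢ}`, the `Tᵢ` being prime elements of the domain `Λ`
  haveI : IsDomain (MvPowerSeries (Fin m) k) := NoZeroDivisors.to_isDomain _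
  obtain ⟨nn, ε, hfac⟩ := exists_eq_units_mul_prod_pow_of_dvd_prod_pow s
    (fun i => (MvPowerSeries.X i : MvPowerSeries (Fin m) k)) (fun i _ => MvPowerSeries.prime_X' k i)
    N hN
  -- the exponents on `Fin m`, vanishing beyond `r`
  let ν : Fin m → ℕ := fun i => if i.val < r then nn i else 0
  have hm₀ : ∏ i ∈ s, (MvPowerSeries.X i : MvPowerSeries (Fin m) k) ^ nn i =
      ∏ i, MvPowerSeries.X i ^ ν i := by
    rw [hs, Finset.prod_filter]
    refine Finset.prod_congr rfl fun i _ => ?_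
    simp only [ν]
    split_ifs <;> simp
  have hrel : Ideal.span {DeJong1996.nodeDeformationRelation (MvPowerSeries (Fin m) k) h} =
      Ideal.span {DeJong1996.nodeDeformationRelation (MvPowerSeries (Fin m) k)
        ((ε : MvPowerSeries (Fin m) k) * ∏ i ∈ s, MvPowerSeries.X i ^ nn i)} := by
    rw [← hfac]
  have hrel' : Ideal.span {DeJong1996.nodeDeformationRelation (MvPowerSeries (Fin m) k)
        (∏ i ∈ s, MvPowerSeries.X i ^ nn i)} =
      Ideal.span {DeJong1996.nodeDeformationRelation (MvPowerSeries (Fin m) k)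
        (∏ i, MvPowerSeries.X i ^ ν i)} := by
    rw [hm₀]
  -- the isomorphism: 2.23, `ε` absorbed into `u`, rebracketed
  refine ⟨ν, (((e.trans (Ideal.quotEquivOfEq hrel)).trans
      (DeJong1996.NodeDeformationRing.absorbUnit ε _)).trans (Ideal.quotEquivOfEq hrel')).trans
      (DeJong1996.NodeDeformationRing.toFormalNodeRing k m ν), fun i hi => ?_, fun i => ?_⟩
  · simp only [ν]
    rw [if_neg (by omega)]
  · rw [RingEquiv.trans_apply, RingEquiv.trans_apply, RingEquiv.trans_apply,
      RingEquiv.trans_apply, he, heA, Ideal.quotEquivOfEq_mk,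
      DeJong1996.NodeDeformationRing.absorbUnit_mk_C, Ideal.quotEquivOfEq_mk,
      DeJong1996.NodeDeformationRing.toFormalNodeRing_mk_C_X]

end Literature.AlgebraicGeometry.Resolution

end
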